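import Mathlib.Algebra.Polynomial.FieldDivision
import Mathlib.Algebra.Polynomial.Derivative
import Mathlib.RingTheory.Polynomial.Chebyshev
import Mathlib.Analysis.SpecialFunctions.Integrals.Basic
import Mathlib.MeasureTheory.Integral.IntervalIntegral.IntegrationByParts
import Mathlib.Topology.Algebra.Polynomial
import Mathlib.Analysis.Calculus.Deriv.Polynomial
import HarnessLib

/-!
# Legendre polynomials on `[-1, 1]`: Rodrigues' formula, orthogonality, norms, and the pairing with
# Chebyshev polynomials

Topic `Literature/Analysis/SpecialFunctions` (classical special-function analysis). Motivation and
first use: the analytic input of Chelkak–Hongler–Mahfouf's short proof of **Wu's formula** for the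
critical diagonal spin correlations of the planar Ising model (D. Chelkak, C. Hongler, R. Mahfouf,
Ann. Inst. Fourier 74 (2024) = arXiv:1904.09168, Appendix §6, Lemma 6.2 and Thm 6.3: the full-plane
Kadanoff–Ceva spinor is `(C_n/2π) ∫ e^{-ikt} y(t)^s P_n(cos t) dt`, and Wu's recurrence
`D_{n+1}/D_n = (2/π)((2n)‼)²/((2n-1)‼(2n+1)‼)` comes out of `∫_{-1}^1 T_k P_n = 0` (`k < n`),
`∫_{-1}^1 T_n P_n = (t_n/p_n) ‖P_n‖²` and `‖P_n‖² = 2/(2n+1)`, with `p_n`, `t_n` the leading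
coefficients of `P_n`, `T_n`), cf. `Literature.Probability.LatticeModels.wuRatio`
(`PlanarIsingWuDiag.lean`). Everything here is PROVED; no named fact.

Following CHM (and Rodrigues 1816; Andrews–Askey–Roy, Remark 2.5.1, (2.5.13') with `α = β = 0`)
we *define* `P_n := (2^n n!)^{-1} dⁿ/dxⁿ (x² - 1)ⁿ ∈ ℝ[X]` and prove:

* `natDegree_legendre`, `leadingCoeff_legendre` — `deg P_n = n`, `p_n = (2n)!/(2^n (n!)²)`;
* `integral_iterate_derivative_legendreW_mul` — the `n`-fold integration by parts
  `∫_{-1}^1 (dⁿW) q = (-1)^j ∫_{-1}^1 (d^{n-j}W) q^{(j)}` (`W = (x²-1)ⁿ`; the boundary terms vanish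
  because `±1` are roots of multiplicity `n`);
* `integral_legendre_mul_eq_zero` — **orthogonality** `∫_{-1}^1 P_n q = 0` for `deg q < n`, in
  particular `∫_{-1}^1 P_n P_m = 0` (`m < n`) and `∫_{-1}^1 T_k P_n = 0` (`k < n`);
* `integral_one_sub_sq_pow` — `∫_{-1}^1 (1 - x²)ⁿ dx = 2 ∏_{i<n} (2i+2)/(2i+3)` (`= ∫₀^π sin^{2n+1}`);
* `integral_legendre_sq` — **the norm** `∫_{-1}^1 P_n² = 2/(2n+1)` (AAR (2.5.14), `α = β = 0`);
* `integral_chebyshevT_mul_legendre` — `∫_{-1}^1 T_n P_n = (2^{n-1}/p_n) · 2/(2n+1)` (CHM, proof of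
  Thm 6.3; for `n = 0` both sides are `2` thanks to `2^{0-1} = 1` in `ℕ`).

Mathlib status: `Polynomial.shiftedLegendre n ∈ ℤ[X]` is `P_n(1 - 2X)` (Rodrigues form
`n! · P̃_n = dⁿ[Xⁿ(1-X)ⁿ]`, used for irrationality proofs) and has no orthogonality or norm lemmas;
the bridge to it is not needed here and is not proved. Chebyshev: `Polynomial.Chebyshev.T`,
`leadingCoeff_T`, `natDegree_T` are Mathlib's. The tree's `HypergeometricPolynomialOrthogonality`
treats the Jacobi weights `z^{c-1}(1-z)^{1-c}`, `1 < c < 2`, which excludes the Legendre case `c = 1`.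

## References

* G. E. Andrews, R. Askey, R. Roy, *Special Functions*, CUP 1999, Def. 2.5.1, Remark 2.5.1
  (2.5.13'), (2.5.14). [AndrewsAskeyRoy1999]
* D. Chelkak, C. Hongler, R. Mahfouf, Ann. Inst. Fourier 74 (2024) 2275–2330, Appendix §6.
  [ChelkakHonglerMahfouf2024]
-/

noncomputable section

open Polynomial intervalIntegral MeasureTheory Finset
open scoped Nat

namespace Literature.Analysis.SpecialFunctions

/-! ### Rodrigues' formula as the definition -/

/-- `W_n = (X² - 1)ⁿ`, the polynomial in Rodrigues' formula. [cite: AndrewsAskeyRoy1999, Remark 2.5.1 eq. (2.5.13')] -/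
def legendreW (n : ℕ) : ℝ[X] := (X ^ 2 - 1) ^ n

/-- **The Legendre polynomial** `P_n = (2ⁿ n!)⁻¹ · dⁿ/dxⁿ (x² - 1)ⁿ ∈ ℝ[X]` (Rodrigues' formula,
taken as the definition as in Chelkak–Hongler–Mahfouf, Lemma 6.2).
[cite: AndrewsAskeyRoy1999, Remark 2.5.1 eq. (2.5.13') (α = β = 0)] -/
def legendre (n : ℕ) : ℝ[X] :=
  C (1 / (2 ^ n * (n ! : ℝ))) * derivative^[n] (legendreW n)

/-- `P_0 = 1`. [folklore] -/
theorem legendre_zero : legendre 0 = 1 := by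
  simp [legendre, legendreW]

/-- `P_1 = X`. [folklore] -/
theorem legendre_one : legendre 1 = X := by
  simp only [legendre, legendreW, pow_one, Function.iterate_one, derivative_sub, derivative_X_pow,
    derivative_one, Nat.cast_ofNat, sub_zero, Nat.factorial_one, Nat.cast_one, mul_one]
  rw [show (C (2 : ℝ) : ℝ[X]) = C 2 from rfl, ← mul_assoc, ← C_mul]
  norm_num

/-! ### Degree and leading coefficient -/

/-- `W_n = (X - 1)ⁿ (X + 1)ⁿ`. [folklore] -/
theorem legendreW_eq_mul (n : ℕ) : legendreW n = (X - C 1) ^ n * (X - C (-1)) ^ n := by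
  rw [legendreW, ← mul_pow]
  congr 1
  simp only [map_one, map_neg, sub_neg_eq_add]
  ring

/-- `W_n` is monic. [folklore] -/
theorem monic_legendreW (n : ℕ) : (legendreW n).Monic := by
  have h : (X ^ 2 - 1 : ℝ[X]).Monic := by
    simpa using monic_X_pow_sub_C (1 : ℝ) two_ne_zero
  exact h.pow n

/-- `deg W_n = 2n`. [folklore] -/
theorem natDegree_legendreW (n : ℕ) : (legendreW n).natDegree = 2 * n := by
  have h : (X ^ 2 - 1 : ℝ[X]).Monic := by
    simpa using monic_X_pow_sub_C (1 : ℝ) two_ne_zero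
  have h2 : (X ^ 2 - 1 : ℝ[X]).natDegree = 2 := by
    simpa using natDegree_X_pow_sub_C (n := 2) (r := (1 : ℝ))
  rw [legendreW, h.natDegree_pow, h2, mul_comm]

/-- `W_n ≠ 0`. [folklore] -/
theorem legendreW_ne_zero (n : ℕ) : legendreW n ≠ 0 := (monic_legendreW n).ne_zero

/-- The coefficients of `dⁿ W_n`: `coeff m (dⁿ W_n) = (m+n)!/m! · coeff (m+n) W_n`, so the `n`-th
one is `(2n)!/n!` and the higher ones vanish. [folklore] -/
theorem coeff_iterate_derivative_legendreW (n m : ℕ) :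
    (derivative^[n] (legendreW n)).coeff m = ((m + n).descFactorial n : ℝ) * (legendreW n).coeff (m + n) := by
  rw [coeff_iterate_derivative, nsmul_eq_mul]

/-- `coeff n (dⁿ W_n) = (2n)!/n! = (2n).descFactorial n`. [folklore] -/
theorem coeff_iterate_derivative_legendreW_self (n : ℕ) :
    (derivative^[n] (legendreW n)).coeff n = ((2 * n).descFactorial n : ℝ) := by
  rw [coeff_iterate_derivative_legendreW, show n + n = 2 * n by ring]
  have : (legendreW n).coeff (2 * n) = 1 := by
    rw [← natDegree_legendreW n]
    exact (monic_legendreW n).coeff_natDegree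
  rw [this, mul_one]

/-- `deg dⁿ W_n ≤ n`. [folklore] -/
theorem natDegree_iterate_derivative_legendreW_le (n : ℕ) :
    (derivative^[n] (legendreW n)).natDegree ≤ n := by
  refine (natDegree_iterate_derivative _ _).trans ?_
  rw [natDegree_legendreW]; omega

/-- `deg P_n ≤ n`. [folklore] -/
theorem natDegree_legendre_le (n : ℕ) : (legendre n).natDegree ≤ n := by
  unfold legendre
  exact (natDegree_C_mul_le _ _).trans (natDegree_iterate_derivative_legendreW_le n)

/-- The leading coefficient `p_n := (2n)! / (2ⁿ (n!)²)` of `P_n`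
(Chelkak–Hongler–Mahfouf: `p_n = (2ⁿ n!)⁻¹ (2n)!/n!`). [cite: ChelkakHonglerMahfouf2024, Appendix §6, proof of Thm. 6.3] -/
def legendreLead (n : ℕ) : ℝ := ((2 * n)! : ℝ) / (2 ^ n * ((n ! : ℝ)) ^ 2)

/-- `p_n > 0`. [folklore] -/
theorem legendreLead_pos (n : ℕ) : 0 < legendreLead n := by
  unfold legendreLead; positivity

/-- `coeff n P_n = p_n`. [folklore] -/
theorem coeff_legendre_self (n : ℕ) : (legendre n).coeff n = legendreLead n := by
  rw [legendre, coeff_C_mul, coeff_iterate_derivative_legendreW_self, legendreLead]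
  have h := Nat.factorial_mul_descFactorial (show n ≤ 2 * n by omega)
  rw [show 2 * n - n = n by omega] at h
  have h' : ((2 * n).descFactorial n : ℝ) = ((2 * n)! : ℝ) / (n ! : ℝ) := by
    rw [eq_div_iff (by positivity), mul_comm]
    exact_mod_cast h
  rw [h']
  field_simp

/-- **`deg P_n = n`.** [folklore] -/
theorem natDegree_legendre (n : ℕ) : (legendre n).natDegree = n := by
  refine le_antisymm (natDegree_legendre_le n) ?_
  refine le_natDegree_of_ne_zero ?_
  rw [coeff_legendre_self]
  exact (legendreLead_pos n).ne'

/-- **The leading coefficient of `P_n` is `p_n = (2n)!/(2ⁿ (n!)²)`.** [cite: ChelkakHonglerMahfouf2024, Appendix §6, proof of Thm. 6.3] -/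
theorem leadingCoeff_legendre (n : ℕ) : (legendre n).leadingCoeff = legendreLead n := by
  rw [leadingCoeff, natDegree_legendre, coeff_legendre_self]

/-- `P_n ≠ 0`. [folklore] -/
theorem legendre_ne_zero (n : ℕ) : legendre n ≠ 0 := by
  intro h
  have := coeff_legendre_self n
  rw [h, coeff_zero] at this
  exact (legendreLead_pos n).ne this

/-- The `n`-th derivative of a polynomial of degree `≤ n` is the constant `n! · coeff n`. [folklore] -/
theorem iterate_derivative_eq_C_of_natDegree_le {p : ℝ[X]} {n : ℕ} (hp : p.natDegree ≤ n) :
    derivative^[n] p = C ((n ! : ℝ) * p.coeff n) := by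
  ext m
  rw [coeff_iterate_derivative, nsmul_eq_mul, coeff_C]
  rcases Nat.eq_zero_or_pos m with rfl | hm
  · simp [Nat.descFactorial_self]
  · rw [if_neg hm.ne', coeff_eq_zero_of_natDegree_lt (by omega), mul_zero]

/-- `dⁿ P_n = n! p_n` (a constant). [folklore] -/
theorem iterate_derivative_legendre (n : ℕ) :
    derivative^[n] (legendre n) = C ((n ! : ℝ) * legendreLead n) := by
  rw [iterate_derivative_eq_C_of_natDegree_le (natDegree_legendre_le n), coeff_legendre_self]

/-! ### Vanishing of `d^j W_n` at `±1` for `j < n` -/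

/-- `±1` are roots of `W_n` of multiplicity `≥ n`. [folklore] -/
theorem le_rootMultiplicity_legendreW (n : ℕ) :
    n ≤ (legendreW n).rootMultiplicity 1 ∧ n ≤ (legendreW n).rootMultiplicity (-1) := by
  constructor
  · rw [le_rootMultiplicity_iff (legendreW_ne_zero n), legendreW_eq_mul]
    exact Dvd.intro _ rfl
  · rw [le_rootMultiplicity_iff (legendreW_ne_zero n), legendreW_eq_mul]
    exact Dvd.intro_left _ rfl

/-- For `j < n`, `(d^j W_n)(1) = (d^j W_n)(-1) = 0`. [folklore] -/
theorem eval_iterate_derivative_legendreW_eq_zero {n j : ℕ} (hj : j < n) :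
    (derivative^[j] (legendreW n)).eval 1 = 0 ∧ (derivative^[j] (legendreW n)).eval (-1) = 0 :=
  ⟨(isRoot_iterate_derivative_of_lt_rootMultiplicity
      (hj.trans_le (le_rootMultiplicity_legendreW n).1)).eq_zero,
    (isRoot_iterate_derivative_of_lt_rootMultiplicity
      (hj.trans_le (le_rootMultiplicity_legendreW n).2)).eq_zero⟩

/-! ### Integration by parts on `[-1, 1]` -/

/-- Integration by parts for polynomials on `[-1, 1]`:
`∫ f' g = f(1)g(1) - f(-1)g(-1) - ∫ f g'`. [folklore] -/
theorem integral_derivative_mul (f g : ℝ[X]) :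
    ∫ x in (-1 : ℝ)..1, (derivative f).eval x * g.eval x =
      f.eval 1 * g.eval 1 - f.eval (-1) * g.eval (-1) -
        ∫ x in (-1 : ℝ)..1, f.eval x * (derivative g).eval x := by
  have h := integral_mul_deriv_eq_deriv_mul (a := (-1 : ℝ)) (b := 1)
    (u := fun x => g.eval x) (v := fun x => f.eval x)
    (u' := fun x => (derivative g).eval x) (v' := fun x => (derivative f).eval x)
    (fun x _ => g.hasDerivAt x) (fun x _ => f.hasDerivAt x)
    ((Polynomial.continuous _).intervalIntegrable _ _)
    ((Polynomial.continuous _).intervalIntegrable _ _)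
  calc ∫ x in (-1 : ℝ)..1, (derivative f).eval x * g.eval x
      = ∫ x in (-1 : ℝ)..1, g.eval x * (derivative f).eval x := by
        refine intervalIntegral.integral_congr fun x _ => ?_; ring
    _ = g.eval 1 * f.eval 1 - g.eval (-1) * f.eval (-1) -
          ∫ x in (-1 : ℝ)..1, (derivative g).eval x * f.eval x := h
    _ = _ := by
        rw [mul_comm (g.eval 1), mul_comm (g.eval (-1))]
        congr 1
        refine intervalIntegral.integral_congr fun x _ => ?_; ring

/-- **The `n`-fold integration by parts behind Rodrigues' formula**: for `j ≤ n` and every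
polynomial `q`, `∫_{-1}^1 (dⁿ W_n) q = (-1)^j ∫_{-1}^1 (d^{n-j} W_n) q^{(j)}` (all boundary terms vanish
by `eval_iterate_derivative_legendreW_eq_zero`). [cite: AndrewsAskeyRoy1999, (2.5.14) ("use (2.5.13) and integration by parts")] -/
theorem integral_iterate_derivative_legendreW_mul (n : ℕ) {j : ℕ} (hj : j ≤ n) (q : ℝ[X]) :
    ∫ x in (-1 : ℝ)..1, (derivative^[n] (legendreW n)).eval x * q.eval x =
      (-1) ^ j * ∫ x in (-1 : ℝ)..1,
        (derivative^[n - j] (legendreW n)).eval x * (derivative^[j] q).eval x := by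
  induction j with
  | zero => simp
  | succ j ih =>
    rw [ih (Nat.le_of_succ_le hj)]
    have hlt : j < n := hj
    -- `d^{n-j} W = (d^{n-j-1} W)'`
    have hsplit : derivative^[n - j] (legendreW n) =
        derivative (derivative^[n - (j + 1)] (legendreW n)) := by
      rw [← Function.iterate_succ_apply' derivative]
      congr 1; omega
    rw [hsplit, integral_derivative_mul]
    have hvan := eval_iterate_derivative_legendreW_eq_zero (n := n) (j := n - (j + 1)) (by omega)
    rw [hvan.1, hvan.2, zero_mul, zero_mul, sub_zero, zero_sub, Function.iterate_succ_apply']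
    ring

/-! ### Orthogonality -/

/-- **Orthogonality of `P_n` to all polynomials of lower degree**: `∫_{-1}^1 P_n q = 0` whenever
`deg q < n`. [cite: AndrewsAskeyRoy1999, (2.5.14) (α = β = 0)] -/
theorem integral_legendre_mul_eq_zero {n : ℕ} {q : ℝ[X]} (hq : q.degree < n) :
    ∫ x in (-1 : ℝ)..1, (legendre n).eval x * q.eval x = 0 := by
  have h := integral_iterate_derivative_legendreW_mul n le_rfl q
  rw [iterate_derivative_eq_zero_of_degree_lt hq] at h
  simp only [eval_zero, mul_zero, intervalIntegral.integral_zero] at h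
  simp only [legendre, eval_mul, eval_C, mul_assoc]
  rw [intervalIntegral.integral_const_mul, h, mul_zero]

/-- `∫_{-1}^1 P_n P_m = 0` for `m < n`. [cite: AndrewsAskeyRoy1999, (2.5.14) (α = β = 0)] -/
theorem integral_legendre_mul_legendre_eq_zero {n m : ℕ} (hmn : m < n) :
    ∫ x in (-1 : ℝ)..1, (legendre n).eval x * (legendre m).eval x = 0 :=
  integral_legendre_mul_eq_zero
    ((degree_le_of_natDegree_le (natDegree_legendre_le m)).trans_lt (by exact_mod_cast hmn))

/-- `∫_{-1}^1 T_k P_n = 0` for `k < n` (the Chebyshev polynomial `T_k` has degree `k`): the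
orthogonality used by Chelkak–Hongler–Mahfouf to verify the harmonicity of their explicit spinor.
[cite: ChelkakHonglerMahfouf2024, Appendix §6, proof of Lemma 6.2] -/
theorem integral_chebyshevT_mul_legendre_eq_zero {n k : ℕ} (hkn : k < n) :
    ∫ x in (-1 : ℝ)..1, (Chebyshev.T ℝ k).eval x * (legendre n).eval x = 0 := by
  have hdeg : (Chebyshev.T ℝ k).degree < n := by
    refine (degree_le_of_natDegree_le (le_of_eq ?_)).trans_lt (by exact_mod_cast hkn)
    rw [Chebyshev.natDegree_T]; simp
  rw [← integral_legendre_mul_eq_zero hdeg]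
  refine intervalIntegral.integral_congr fun x _ => ?_
  simp only [mul_comm]

/-! ### The norm `‖P_n‖² = 2/(2n+1)` -/

/-- `∫_{-1}^1 (1 - x²)ⁿ dx = ∫₀^π sin^{2n+1} θ dθ = 2 ∏_{i<n} (2i+2)/(2i+3)` (substitution `x = cos θ`).
[folklore] -/
theorem integral_one_sub_sq_pow (n : ℕ) :
    ∫ x in (-1 : ℝ)..1, (1 - x ^ 2) ^ n = 2 * ∏ i ∈ range n, (2 * (i : ℝ) + 2) / (2 * i + 3) := by
  rw [← integral_sin_pow_odd]
  have h : ∫ x in (0 : ℝ)..Real.pi, ((fun y : ℝ => (1 - y ^ 2) ^ n) ∘ Real.cos) x * (-Real.sin x) =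
      ∫ y in (Real.cos 0)..(Real.cos Real.pi), (1 - y ^ 2) ^ n :=
    integral_comp_mul_deriv (f' := fun x => -Real.sin x) (fun x _ => Real.hasDerivAt_cos x)
      (Real.continuous_sin.neg.continuousOn) (by fun_prop)
  rw [Real.cos_zero, Real.cos_pi, intervalIntegral.integral_symm (-1 : ℝ) 1] at h
  have h2 : ∫ x in (0 : ℝ)..Real.pi, Real.sin x ^ (2 * n + 1) =
      -∫ x in (0 : ℝ)..Real.pi, ((fun y : ℝ => (1 - y ^ 2) ^ n) ∘ Real.cos) x * (-Real.sin x) := by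
    rw [← intervalIntegral.integral_neg]
    refine intervalIntegral.integral_congr fun x _ => ?_
    simp only [Function.comp_apply]
    rw [show (1 : ℝ) - Real.cos x ^ 2 = Real.sin x ^ 2 by nlinarith [Real.sin_sq_add_cos_sq x]]
    ring
  rw [h2, h, neg_neg]

/-- `∏_{i<n} (2i+2) = 2ⁿ n!`. [folklore] -/
theorem prod_range_even (n : ℕ) : ∏ i ∈ range n, (2 * (i : ℝ) + 2) = 2 ^ n * (n ! : ℝ) := by
  induction n with
  | zero => simp
  | succ n ih => rw [prod_range_succ, ih, Nat.factorial_succ]; push_cast; ring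

/-- `2ⁿ n! ∏_{i<n} (2i+3) = (2n+1)!`. [folklore] -/
theorem prod_range_odd (n : ℕ) :
    2 ^ n * (n ! : ℝ) * ∏ i ∈ range n, (2 * (i : ℝ) + 3) = ((2 * n + 1)! : ℝ) := by
  induction n with
  | zero => simp
  | succ n ih =>
    rw [prod_range_succ, Nat.factorial_succ n, show 2 * (n + 1) + 1 = 2 * n + 1 + 1 + 1 by ring,
      Nat.factorial_succ, Nat.factorial_succ (2 * n + 1)]
    push_cast
    rw [← ih]
    ring

/-- The factorial bookkeeping `(2n+1)! · ∏_{i<n} (2i+2)/(2i+3) = 4ⁿ (n!)²` (Wallis' quotients).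
[folklore] -/
theorem factorial_mul_wallis_prod (n : ℕ) :
    ((2 * n + 1)! : ℝ) * ∏ i ∈ range n, (2 * (i : ℝ) + 2) / (2 * i + 3) = 4 ^ n * (n ! : ℝ) ^ 2 := by
  rw [prod_div_distrib, prod_range_even, ← prod_range_odd]
  have hT : (∏ i ∈ range n, (2 * (i : ℝ) + 3)) ≠ 0 := prod_ne_zero_iff.2 fun i _ => by positivity
  have h4 : (4 : ℝ) ^ n = 2 ^ n * 2 ^ n := by rw [← mul_pow]; norm_num
  rw [h4, mul_div_assoc', div_eq_iff hT]
  ring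

/-- `(-1)ⁿ ((-1)ⁿ y · w) = y · w`. [folklore] -/
theorem neg_one_pow_mul_neg_one_pow_mul (n : ℕ) (y w : ℝ) :
    (-1 : ℝ) ^ n * ((-1) ^ n * y * w) = y * w := by
  have h : (-1 : ℝ) ^ n * (-1) ^ n = 1 := by rw [← mul_pow]; norm_num
  calc (-1 : ℝ) ^ n * ((-1) ^ n * y * w) = (-1 : ℝ) ^ n * (-1) ^ n * (y * w) := by ring
    _ = y * w := by rw [h, one_mul]

/-- **The norm of the Legendre polynomial**: `∫_{-1}^1 P_n(x)² dx = 2/(2n+1)`.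
[cite: AndrewsAskeyRoy1999, (2.5.14) (α = β = 0)] -/
theorem integral_legendre_sq (n : ℕ) :
    ∫ x in (-1 : ℝ)..1, (legendre n).eval x ^ 2 = 2 / (2 * n + 1) := by
  -- `∫ P_n · P_n = c ∫ (dⁿW) P_n = c (-1)ⁿ ∫ W · (n! p_n)`
  have h := integral_iterate_derivative_legendreW_mul n le_rfl (legendre n)
  rw [iterate_derivative_legendre, Nat.sub_self, Function.iterate_zero_apply] at h
  have hW : ∀ x : ℝ, (legendreW n).eval x = (-1) ^ n * (1 - x ^ 2) ^ n := by
    intro x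
    simp only [legendreW, eval_pow, eval_sub, eval_X, eval_one]
    rw [← mul_pow]; ring
  have hI : ∫ x in (-1 : ℝ)..1, (legendreW n).eval x * (C ((n ! : ℝ) * legendreLead n)).eval x =
      (-1) ^ n * ((n ! : ℝ) * legendreLead n) * ∫ x in (-1 : ℝ)..1, (1 - x ^ 2) ^ n := by
    rw [← intervalIntegral.integral_const_mul]
    refine intervalIntegral.integral_congr fun x _ => ?_
    simp only [eval_C, hW]; ring
  rw [hI, integral_one_sub_sq_pow] at h
  calc ∫ x in (-1 : ℝ)..1, (legendre n).eval x ^ 2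
      = ∫ x in (-1 : ℝ)..1, (1 / (2 ^ n * (n ! : ℝ))) *
          ((derivative^[n] (legendreW n)).eval x * (legendre n).eval x) := by
        refine intervalIntegral.integral_congr fun x _ => ?_
        simp only [legendre, eval_mul, eval_C]; ring
    _ = (1 / (2 ^ n * (n ! : ℝ))) * ((-1) ^ n * ((-1) ^ n * ((n ! : ℝ) * legendreLead n) *
          (2 * ∏ i ∈ range n, (2 * (i : ℝ) + 2) / (2 * i + 3)))) := by
        rw [intervalIntegral.integral_const_mul, h]
    _ = legendreLead n / 2 ^ n * (2 * ∏ i ∈ range n, (2 * (i : ℝ) + 2) / (2 * i + 3)) := by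
        have hn : (n ! : ℝ) ≠ 0 := by positivity
        rw [neg_one_pow_mul_neg_one_pow_mul]
        field_simp
    _ = 2 / (2 * n + 1) := by
        have key := factorial_mul_wallis_prod n
        rw [Nat.factorial_succ] at key
        push_cast at key
        have h2n : ((2 * n)! : ℝ) ≠ 0 := by positivity
        have hn : (n ! : ℝ) ≠ 0 := by positivity
        have h3 : (2 * (n : ℝ) + 1) ≠ 0 := by positivity
        have hS : ∏ i ∈ range n, (2 * (i : ℝ) + 2) / (2 * i + 3) =
            4 ^ n * (n ! : ℝ) ^ 2 / ((2 * n + 1) * (2 * n)!) := by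
          rw [eq_div_iff (by positivity)]
          linarith [key]
        have h4 : (4 : ℝ) ^ n = 2 ^ n * 2 ^ n := by rw [← mul_pow]; norm_num
        rw [hS, h4]
        unfold legendreLead
        field_simp

/-! ### The pairing with the Chebyshev polynomial of the same degree -/

/-- **`∫_{-1}^1 T_n P_n = (t_n/p_n) ‖P_n‖² = 2^{n-1}/p_n · 2/(2n+1)`** (`t_n = 2^{n-1}` the leading
coefficient of `T_n`, `n ≥ 1`; at `n = 0` both sides equal `2`, `2^{0-1} = 1` in `ℕ`): `T_n - (t_n/p_n) P_n`
has degree `< n`, hence is orthogonal to `P_n`. This is the identity from which Chelkak–Hongler–Mahfouf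
read off Wu's recurrence. [cite: ChelkakHonglerMahfouf2024, Appendix §6, proof of Thm. 6.3] -/
theorem integral_chebyshevT_mul_legendre (n : ℕ) :
    ∫ x in (-1 : ℝ)..1, (Chebyshev.T ℝ n).eval x * (legendre n).eval x =
      (2 : ℝ) ^ (n - 1) / legendreLead n * (2 / (2 * n + 1)) := by
  set a : ℝ := (2 : ℝ) ^ (n - 1) / legendreLead n with ha
  set R : ℝ[X] := Chebyshev.T ℝ n - C a * legendre n with hR
  have hp : 0 < legendreLead n := legendreLead_pos n
  have ha0 : a ≠ 0 := by positivity
  have hdegT : (Chebyshev.T ℝ n).degree = n := by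
    rw [Chebyshev.degree_T]; simp
  have hdegP : (C a * legendre n).degree = n := by
    rw [degree_C_mul ha0, degree_eq_natDegree (legendre_ne_zero n), natDegree_legendre]
  -- the remainder `R = T_n - (t_n/p_n) P_n` has degree `< n`
  have hRdeg : R.degree < n := by
    have hT0 : Chebyshev.T ℝ n ≠ 0 := by
      intro h; rw [h, degree_zero] at hdegT; exact WithBot.bot_ne_coe hdegT
    have hlc : (Chebyshev.T ℝ n).leadingCoeff = (C a * legendre n).leadingCoeff := by
      rw [Chebyshev.leadingCoeff_T, leadingCoeff_mul, leadingCoeff_C, leadingCoeff_legendre, ha,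
        div_mul_cancel₀ _ hp.ne']
      simp
    have := degree_sub_lt (hdegT.trans hdegP.symm) hT0 hlc
    rwa [hdegT] at this
  have hsplit : ∀ x : ℝ, (Chebyshev.T ℝ n).eval x * (legendre n).eval x =
      (legendre n).eval x * R.eval x + a * (legendre n).eval x ^ 2 := by
    intro x
    have : Chebyshev.T ℝ n = R + C a * legendre n := by rw [hR, sub_add_cancel]
    rw [this, eval_add, eval_mul, eval_C]; ring
  simp_rw [hsplit]
  have hi1 : IntervalIntegrable (fun x : ℝ => (legendre n).eval x * R.eval x) volume (-1) 1 :=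
    ((legendre n).continuous.mul R.continuous).intervalIntegrable _ _
  have hi2 : IntervalIntegrable (fun x : ℝ => a * (legendre n).eval x ^ 2) volume (-1) 1 :=
    (continuous_const.mul ((legendre n).continuous.pow 2)).intervalIntegrable _ _
  rw [intervalIntegral.integral_add hi1 hi2, integral_legendre_mul_eq_zero hRdeg, zero_add,
    intervalIntegral.integral_const_mul, integral_legendre_sq]

end Literature.Analysis.SpecialFunctions
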